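/-
Copyright (c) 2026 the pub-hodgecm-mathlib formalisation cell (harness21).  Typist seat hodgecm-mathlib-R90-C11-typ1 (g4), R90-TF section S2 «Ch11-arch»
(S2 dealer K2E1b-plan (g8), DESK WORDS ×6 2026-09-05T02:47:25Z item (3) + RULING 02:52:23Z «(T9) with the clearer name `Theorems/R90S2Stable1233bOfLetters.lean :: R90_S2_stable1233b_of_letters`»):
the OF-LETTERS TIE for socket σ9 (Prop. 12.3.3 (b)): the virtual character `Θ_{πⁿ(p,q,t)} − Θ_{dsInf(p,q,t)}` of the kit's A-pair of record is a stable distribution on `C_c^∞(G_∞)` for the family `m`, FROM the `∀`-closure of letter ℓ7.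
-/
import Summits.HodgeConjecture.HodgeConjecture.Theorems.R90S2InnerTransferLawLettersDefs   -- ★ the KT-side letters ℓ5 ∕ ℓ6 ∕ ℓ7 (R90-C11-typ1 (g4), filed by K2-defs1 (g8)): `InnerTransferCharLetter`, `EndoCharXiLetter`, `StableVirtualCharLetter` + their `_iff`s
import HarnessLib

/-!
# R90 ∕ S2 «Ch11-arch», OF-LETTERS TIE (T9) for socket σ9 `stub_R90_1233b_cm` —
# `R90_S2_stable1233b_of_letters : (∀ p q t, StableVirtualCharLetter L ι νqi m p q t) → ∀ p q t, IsArchStableDistOn L (splitForm L 3) m (a ↦ Θ_{(archPacketAt … p q t).πn}(a) − Θ_{dsInfOfRecord p q t}(a))`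

Cell `pub/hodgecm-mathlib` (D-0151), crux H413 = `stmt-HodgeConjecture-24833` (`--supports … --as helper`; closes nothing by itself).  ONE theorem, no definition ∕
instance ∕ notation ∕ named fact ∕ `sorry`; sole project import = ★ `R90S2InnerTransferLawLettersDefs` (LAW L9 ∕ S2-R10′: no `Cruxes/…/Lines` import — the orbital family `m`
on `G_∞ = U(Φ₃)_∞` is a PARAMETER here, in ℓ7's binder bytes; the Lines edition instantiates it at a `ComparisonKit`'s `𝔨.mqi` under `𝔨.ArchCoherence hanis νGi νqi νHi`).
THE TIE (TopC, next edition, socket σ9 `stub_R90_1233b_cm` :191–:216, statement FROZEN): after `intro hanis 𝔨 hcoh` the goal is LITERALLY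
`∀ p q t : ℤ, IsArchStableDistOn L (splitForm L 3) 𝔨.mqi (fun a => archTrGOfRecord L ι νqi ((archPacketAt jInfOfRecord dsInfOfRecord p q t).πn) a - archTrGOfRecord L ι νqi
(dsInfOfRecord p q t) a)` (TopC's `splitForm` = ★ `F0P3InnerFormClassificationV6.splitForm` reducibly), closed by `exact R90_S2_stable1233b_of_letters L ι νqi 𝔨.mqi ‹the ℓ7 instances
at 𝔨, from the edition's letter-stub›` (junction certified in the socket's own frame: typ1 (g4) scratch `JUNCTION-L567.v0.lean` 01215cf9e76d3eff, J-L7a∕b).  The proof is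
modus ponens on ★ `stableVirtualCharLetter_iff_socket` (ℓ7 is stated on the carriers of record `jInfOfRecord ∕ dsInfOfRecord`; the kit token `(archPacketAt … p q t).πn`
equals `jInfOfRecord p q t` for every triple, ★ `archPacketAt_πn_ofRecord` = ★ PIN #18 on the cohomological locus + ★ `archPacketAt_πn_of_not` off it).  Print: Prop. 12.3.3 (b)
p. 178 «`Tr(πⁿ(ξ)(f)) − Tr(πˢ(ξ)(f))` defines a stable distribution», §4.1 p. 39 (stable distributions, here guarded to `C_c^∞(G_∞)` = ★ `IsArchStableDistOn`).
HONEST LABEL: HC_CM is proved only modulo the 7 printed citations (2 remaining named inputs: hLiu418 = stmt-HodgeConjecture-24832, h413 =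
stmt-HodgeConjecture-24833) until rung 0 closes; this file proves ONE implication of an `Iff` already in the tree — it discharges no socket by itself (the
letter instances it consumes are typed debt stated by the Lines edition), establishes no character identity, and leaves the code-`sorry` count of record unchanged.

## References
* [Rogawski1990] J. Rogawski, *Automorphic Representations of Unitary Groups in Three Variables*, Annals of Math. Studies 123 (1990), §4.1 p. 39; §12.3 Prop. 12.3.3 (b) p. 178.
-/

set_option autoImplicit false
set_option linter.dupNamespace false

noncomputable section

open MeasureTheory MeasureTheory.Measure NumberField IsDedekindDomain
open scoped Matrix MatrixGroups Classical

namespace Summit.HodgeConjecture.HodgeConjecture.R90.S2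

open Literature.NumberTheory Literature.NumberTheory.Automorphic Literature.NumberTheory.Automorphic.UnitaryGroup
open Literature.NumberTheory.Rogawski1990 Literature.NumberTheory.GaloisRepresentations
open Literature.RepresentationTheory
open Literature.RepresentationTheory.KonnoKonno2007 Literature.RepresentationTheory.KonnoKonno2007.RealDualPair
open Literature.RepresentationTheory.KonnoKonno2007.RealDualPair.UForm
open Summit.HodgeConjecture.HodgeConjecture.Cruxes.H413
open Summit.HodgeConjecture.HodgeConjecture.Cruxes.H413.F0P3InnerFormClassificationV6 (Gp Places Cinf)
open Summit.HodgeConjecture.HodgeConjecture.Cruxes.H413.F0P3XiArchPacketOfRecord (archPacketAt archPacketAt_πn_of_not)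
open Summit.HodgeConjecture.HodgeConjecture.Cruxes.H413.F0P3ArchPacketKit
open Summit.HodgeConjecture.HodgeConjecture.Cruxes.H413.K2E1bCarriersOfRecord (jInfOfRecord dsInfOfRecord)

/-- **(T9) σ9 FROM THE LETTERS ℓ7** — for the measure `νqi` on `G_∞ = U(Φ₃)_∞` and the orbital family `m`: if letter ℓ7 holds at EVERY exponent triple `(p, q, t)`
(★ `StableVirtualCharLetter`: `Θ_{J(p,q,t)} − Θ_{D(p,q,t)}` vanishes on every `C_c^∞` test function stably equivalent to zero for `m`), then σ9's goal after `intro hanis 𝔨 hcoh`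
holds at `m := 𝔨.mqi`, in the socket's literal bytes (kit token `(archPacketAt jInfOfRecord dsInfOfRecord p q t).πn`).  Modus ponens on ★ `stableVirtualCharLetter_iff_socket`.
[cite: Rogawski1990, §12.3 Prop. 12.3.3 (b) p. 178; §4.1 p. 39] -/
theorem R90_S2_stable1233b_of_letters (L : Type) [Field L] [NumberField L] [IsCMField L] (ι : L →+* ℂ)
    (νqi : @Measure (UnitaryGroup.arch (↥(maximalRealSubfield L)) L (IsCMField.complexConj L) 3 (F0P3InnerFormClassificationV6.splitForm L 3)) (borel _))
    (m : letI : ∀ γ : UnitaryGroup.arch (↥(maximalRealSubfield L)) L (IsCMField.complexConj L) 3 (F0P3InnerFormClassificationV6.splitForm L 3),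
        MeasurableSpace (UnitaryGroup.arch (↥(maximalRealSubfield L)) L (IsCMField.complexConj L) 3 (F0P3InnerFormClassificationV6.splitForm L 3) ⧸
          Subgroup.centralizer ({γ} : Set (UnitaryGroup.arch (↥(maximalRealSubfield L)) L (IsCMField.complexConj L) 3 (F0P3InnerFormClassificationV6.splitForm L 3)))) := fun _ => borel _;
      OrbitalMeasureFamily (UnitaryGroup.arch (↥(maximalRealSubfield L)) L (IsCMField.complexConj L) 3 (F0P3InnerFormClassificationV6.splitForm L 3)))
    (hℓ7 : ∀ p q t : ℤ, StableVirtualCharLetter L ι νqi m p q t) :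
    ∀ p q t : ℤ, IsArchStableDistOn L (F0P3InnerFormClassificationV6.splitForm L 3) m
      (fun a => archTrGOfRecord L ι νqi ((archPacketAt jInfOfRecord dsInfOfRecord p q t).πn) a
        - archTrGOfRecord L ι νqi (dsInfOfRecord p q t) a) :=
  (stableVirtualCharLetter_iff_socket L ι νqi m).1 hℓ7

end Summit.HodgeConjecture.HodgeConjecture.R90.S2

end
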